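import Mathlib
import Summits.ValiantsHypothesis.ValiantsHypothesis.Theorems.BinomialElusiveBinomialMapsElusiveCollision

/-!
# Crux `BinomialElusive.BinomialMapsElusive` (stmt-ValiantsHypothesis-7393) — ALL local coordinate
# types: pure value or collision

Completes `BinomialElusiveBinomialMapsElusiveCollision` by the TIED coordinates.  Setting: series
`p_j` (`j ∈ σ`) in a Hahn-series field of characteristic `0`, identities
`U_i + V_i = T_i := t^{e_i} + t^{e_i + g_i}`, `U_i = α_i p^{A_i}`, `V_i = β_i p^{B_i}`, `g_i > 0`,
and the decomposition `p_j = single ν_j c_j · w_j` into monomial × principal unit.  The five types of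
a coordinate, the integer vector `n_i` used, and its exact order `ε_i = ord(w^{n_i} - 1)`:

| type | condition | `n_i` | `ε_i` | excluded ("pure") |
|---|---|---|---|---|
| honest-A | `V_i = 0` or `ord V_i > e_i` | `A_i` | `ord(t^{g_i} - t^{-e_i}V_i)` | `V_i = t^{e_i+g_i}` |
| cancelling | `ord V_i < e_i` | `A_i - B_i` | `ord(T_i/V_i)` | — |
| honest-B | `ord V_i = e_i`, `lc V_i = 1` | `B_i` | `ord(t^{g_i} - t^{-e_i}U_i)` | `V_i = t^{e_i}` |
| pure tie | `V_i = λ t^{e_i}`, `λ ∉ {0,1}` | `A_i` | `g_i` | — |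
| tie | `ord V_i = e_i`, `lc V_i = λ ≠ 1`, `V_i ≠ λ t^{e_i}` | `B_i` | `ord(λ^{-1} t^{-e_i} V_i - 1)` | — |

**Theorem `card_le_of_exactOrder_injective`**: if no coordinate is "pure" (excluded column) and the
exact orders `ε_i` (supplied as a function `ε` with one hypothesis per type) are pairwise distinct,
then `#coordinates ≤ #variables` — so every local binomial swallower from fewer variables than
coordinates has a pure coordinate value or a collision `ε_i = ε_j`, `i ≠ j`.  New ingredient:
`tie_monomial_eq`.  (Structure note `Cruxes/BinomialMapsElusive/STRUCTURE-p1.md`, (F1'), (F2).)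
-/

-- layout Summits/ValiantsHypothesis/ValiantsHypothesis forces the duplicated namespace component
set_option linter.dupNamespace false

namespace Summit.ValiantsHypothesis.ValiantsHypothesis.Theorems.BinomialMapsElusiveComplete

open scoped BigOperators
open Finset
open Summit.ValiantsHypothesis.ValiantsHypothesis.Theorems.BinomialMapsElusiveExactOrders
open Summit.ValiantsHypothesis.ValiantsHypothesis.Theorems.BinomialMapsElusiveDeepToric
open Summit.ValiantsHypothesis.ValiantsHypothesis.Theorems.BinomialMapsElusiveCollision

variable {Δ : Type*} [AddCommGroup Δ] [LinearOrder Δ] [IsOrderedAddMonoid Δ]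
  {R : Type*} [Field R]

omit [IsOrderedAddMonoid Δ] in
/-- If a series has order `e` as `orderTop`, its `order` is `e` and its leading coefficient is its
coefficient at `e`. -/
theorem leadingCoeff_eq_coeff_of_orderTop {x : HahnSeries Δ R} {e : Δ} (hx : x.orderTop = e) :
    x ≠ 0 ∧ x.order = e ∧ x.leadingCoeff = x.coeff e := by
  have hne : x ≠ 0 := fun h => by rw [h, HahnSeries.orderTop_zero] at hx; exact WithTop.top_ne_coe hx
  have hord : x.order = e := by
    have := HahnSeries.order_eq_orderTop_of_ne_zero hne
    rw [hx, WithTop.coe_eq_coe] at this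
    exact this
  exact ⟨hne, hord, by rw [HahnSeries.leadingCoeff_eq, hord]⟩

variable [CharZero R]

/-- **Tied coordinate.**  If `U + V = t^e + t^{e+g}` with `U = α p^A`, `V = β p^B`, `ord V = e` and
leading coefficient `λ = lc V ≠ 1`, then `w^B = λ^{-1} t^{-e} V`, and if moreover `V = λ t^e` exactly
then `w^A - 1 = (1 - λ)^{-1} t^g`. -/
theorem tie_monomial_eq {σ : Type*} [Fintype σ] (p w : σ → HahnSeries Δ R) (ν : σ → Δ)
    (c : σ → R) (hpw : ∀ j, p j ≠ 0 → p j = HahnSeries.single (ν j) (c j) * w j)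
    (hw : ∀ j, 0 < (w j - 1).orderTop) (hc : ∀ j, c j ≠ 0)
    (A B : σ → ℕ) (α β : R) (e g : Δ) (hg : 0 < g)
    (hsol : α • ∏ j, p j ^ A j + β • ∏ j, p j ^ B j =
      HahnSeries.single e 1 + HahnSeries.single (e + g) 1)
    (hV : (β • ∏ j, p j ^ B j).orderTop = ((e : Δ) : WithTop Δ))
    (hlc : (β • ∏ j, p j ^ B j).leadingCoeff ≠ 1) :
    (∏ j, w j ^ (B j : ℤ) =
      HahnSeries.single (-e) (β • ∏ j, p j ^ B j).leadingCoeff⁻¹ * (β • ∏ j, p j ^ B j)) ∧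
    ((β • ∏ j, p j ^ B j) = HahnSeries.single e (β • ∏ j, p j ^ B j).leadingCoeff →
      ∏ j, w j ^ (A j : ℤ) - 1 = HahnSeries.single g (1 - (β • ∏ j, p j ^ B j).leadingCoeff)⁻¹) := by
  classical
  set T : HahnSeries Δ R := HahnSeries.single e 1 + HahnSeries.single (e + g) 1 with hT
  set U : HahnSeries Δ R := α • ∏ j, p j ^ A j with hU
  set V : HahnSeries Δ R := β • ∏ j, p j ^ B j with hV'
  obtain ⟨hV_ne, hV_order, hV_lc⟩ := leadingCoeff_eq_coeff_of_orderTop hV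
  set lam : R := V.leadingCoeff with hlam
  have hlam_ne : lam ≠ 0 := HahnSeries.leadingCoeff_ne_zero.mpr hV_ne
  -- decompose `V`
  set WB : HahnSeries Δ R := ∏ j, w j ^ B j with hWB
  set κ' : R := β * ∏ j, c j ^ B j with hκ'
  set EB : Δ := ∑ j, B j • ν j with hEB
  have hVW : V = HahnSeries.single EB κ' * WB := smul_prod_pow_eq p w ν c hpw B β hV_ne
  have hκ'_ne : κ' ≠ 0 := coeff_ne_zero_of_smul_prod_pow_ne_zero p c hc B β hV_ne
  have hWB_pr : 0 < (WB - 1).orderTop :=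
    (lt_orderTop_prod_sub_one Finset.univ (fun j => w j ^ B j) (fun j _ => principal_pow (hw j) _)
      WithTop.zero_ne_top (fun j _ => principal_pow (hw j) _)).1
  have hEB_eq : EB = e := by
    have h := hV
    rw [hVW, HahnSeries.orderTop_mul, HahnSeries.orderTop_single hκ'_ne,
      orderTop_eq_zero_of_principal hWB_pr, add_zero] at h
    exact WithTop.coe_injective h
  have hWB0 : WB.coeff 0 = 1 := by
    have h0 : (WB - 1).coeff 0 = 0 := HahnSeries.coeff_eq_zero_of_lt_orderTop hWB_pr
    rw [HahnSeries.coeff_sub, HahnSeries.coeff_one, if_pos rfl, sub_eq_zero] at h0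
    exact h0
  have hκ'_eq : κ' = lam := by
    have h := hV_lc
    rw [hVW, hEB_eq, HahnSeries.coeff_single_mul, sub_self, hWB0, mul_one] at h
    exact h.symm
  have hsκ : HahnSeries.single e κ' ≠ (0 : HahnSeries Δ R) := HahnSeries.single_ne_zero hκ'_ne
  have hWBeq : WB = HahnSeries.single (-e) lam⁻¹ * V := by
    rw [hVW, hEB_eq, ← mul_assoc, HahnSeries.single_mul_single, neg_add_cancel, hκ'_eq,
      inv_mul_cancel₀ hlam_ne, HahnSeries.single_zero_one, one_mul]
  refine ⟨by simp only [zpow_natCast]; exact hWBeq, fun hpure => ?_⟩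
  -- pure tie: `V = λ t^e`, so `U = (1-λ) t^e + t^{e+g}`
  have hμ : (1 : R) - lam ≠ 0 := sub_ne_zero.mpr (Ne.symm hlc)
  have hUeq : U = HahnSeries.single e (1 - lam) + HahnSeries.single (e + g) 1 := by
    have h : U = T - V := eq_sub_of_add_eq hsol
    rw [h, hT, show V = HahnSeries.single e lam from hpure]
    have : HahnSeries.single e (1 - lam) = HahnSeries.single e (1 : R) - HahnSeries.single e lam := by
      rw [← HahnSeries.single_sub]  -- `single` is additive
    rw [this]; ring
  have hU_ord : U.orderTop = e := by
    rw [hUeq, HahnSeries.orderTop_add_eq_left, HahnSeries.orderTop_single hμ]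
    rw [HahnSeries.orderTop_single hμ, HahnSeries.orderTop_single one_ne_zero, WithTop.coe_lt_coe]
    exact lt_add_of_pos_right e hg
  have hU_ne : U ≠ 0 := (leadingCoeff_eq_coeff_of_orderTop hU_ord).1
  have hU_coeff : U.coeff e = 1 - lam := by
    rw [hUeq, HahnSeries.coeff_add, HahnSeries.coeff_single_same, HahnSeries.coeff_single_of_ne,
      add_zero]
    exact ne_of_lt (lt_add_of_pos_right _ hg)
  set WA : HahnSeries Δ R := ∏ j, w j ^ A j with hWA
  set κ : R := α * ∏ j, c j ^ A j with hκ
  set EA : Δ := ∑ j, A j • ν j with hEA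
  have hUW : U = HahnSeries.single EA κ * WA := smul_prod_pow_eq p w ν c hpw A α hU_ne
  have hκ_ne : κ ≠ 0 := coeff_ne_zero_of_smul_prod_pow_ne_zero p c hc A α hU_ne
  have hWA_pr : 0 < (WA - 1).orderTop :=
    (lt_orderTop_prod_sub_one Finset.univ (fun j => w j ^ A j) (fun j _ => principal_pow (hw j) _)
      WithTop.zero_ne_top (fun j _ => principal_pow (hw j) _)).1
  have hEA_eq : EA = e := by
    have h := hU_ord
    rw [hUW, HahnSeries.orderTop_mul, HahnSeries.orderTop_single hκ_ne,
      orderTop_eq_zero_of_principal hWA_pr, add_zero] at h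
    exact WithTop.coe_injective h
  have hWA0 : WA.coeff 0 = 1 := by
    have h0 : (WA - 1).coeff 0 = 0 := HahnSeries.coeff_eq_zero_of_lt_orderTop hWA_pr
    rw [HahnSeries.coeff_sub, HahnSeries.coeff_one, if_pos rfl, sub_eq_zero] at h0
    exact h0
  have hκ_eq : κ = 1 - lam := by
    have h := hU_coeff
    rw [hUW, hEA_eq, HahnSeries.coeff_single_mul, sub_self, hWA0, mul_one] at h
    exact h
  have hsκA : HahnSeries.single e κ ≠ (0 : HahnSeries Δ R) := HahnSeries.single_ne_zero hκ_ne
  have hWAeq : WA = HahnSeries.single (-e) κ⁻¹ * U := by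
    rw [hUW, hEA_eq, ← mul_assoc, HahnSeries.single_mul_single, neg_add_cancel,
      inv_mul_cancel₀ hκ_ne, HahnSeries.single_zero_one, one_mul]
  simp only [zpow_natCast]
  rw [show (∏ j, w j ^ A j) = WA from rfl, hWAeq, hUeq, hκ_eq, mul_add, HahnSeries.single_mul_single,
    HahnSeries.single_mul_single, neg_add_cancel, inv_mul_cancel₀ hμ, HahnSeries.single_zero_one,
    neg_add_cancel_left, mul_one, add_sub_cancel_left]

omit [CharZero R] in
/-- A coordinate with `ord V = e` and `lc V = 1` is honest with `B` the lower monomial: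
`U = T - V` vanishes to order `> e`. -/
theorem orderTop_gt_of_tie_one {U V : HahnSeries Δ R} {e g : Δ} (hg : 0 < g)
    (hsol : U + V = HahnSeries.single e 1 + HahnSeries.single (e + g) 1)
    (hV : V.orderTop = ((e : Δ) : WithTop Δ)) (hlc : V.leadingCoeff = 1) :
    U = 0 ∨ ((e : Δ) : WithTop Δ) < U.orderTop := by
  obtain ⟨hV_ne, hV_order, hV_lc⟩ := leadingCoeff_eq_coeff_of_orderTop hV
  by_cases hU : U = 0
  · exact Or.inl hU
  refine Or.inr (lt_of_le_of_ne ?_ ?_)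
  · refine HahnSeries.le_orderTop_iff_forall.mpr fun d hd => ?_
    have hd' : d < e := WithTop.coe_lt_coe.mp hd
    have h : U = (HahnSeries.single e 1 + HahnSeries.single (e + g) 1) - V := eq_sub_of_add_eq hsol
    rw [h, HahnSeries.coeff_sub, HahnSeries.coeff_add, HahnSeries.coeff_single_of_ne (ne_of_lt hd'),
      HahnSeries.coeff_single_of_ne (ne_of_lt (lt_trans hd' (lt_add_of_pos_right e hg))), zero_add,
      zero_sub, neg_eq_zero]
    exact HahnSeries.coeff_eq_zero_of_lt_orderTop (by rw [hV]; exact hd)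
  · intro h
    have hc : U.coeff e ≠ 0 := HahnSeries.coeff_orderTop_ne h.symm
    apply hc
    have h' : U = (HahnSeries.single e 1 + HahnSeries.single (e + g) 1) - V := eq_sub_of_add_eq hsol
    rw [h', HahnSeries.coeff_sub, HahnSeries.coeff_add, HahnSeries.coeff_single_same,
      HahnSeries.coeff_single_of_ne (ne_of_lt (lt_add_of_pos_right e hg)), add_zero, ← hV_lc, hlc,
      sub_self]

/-- **Every local coordinate type: pure value or collision.**  With the exact orders `ε_i` of the
table in the module doc-string (one hypothesis per type) pairwise distinct and no pure coordinate
value, `|ι| ≤ |σ|`. -/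
theorem card_le_of_exactOrder_injective {σ ι : Type*} [Fintype σ] [Fintype ι]
    (p : σ → HahnSeries Δ R) (A B : ι → σ → ℕ) (α β : ι → R) (e g : ι → Δ)
    (hg0 : ∀ i, 0 < g i)
    (hsol : ∀ i, α i • ∏ j, p j ^ A i j + β i • ∏ j, p j ^ B i j =
      HahnSeries.single (e i) 1 + HahnSeries.single (e i + g i) 1)
    (ε : ι → WithTop Δ)
    -- honest-A
    (hA : ∀ i, (β i • ∏ j, p j ^ B i j = 0 ∨ ((e i : Δ) : WithTop Δ) < (β i • ∏ j, p j ^ B i j).orderTop) →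
      β i • ∏ j, p j ^ B i j ≠ HahnSeries.single (e i + g i) 1 ∧
      ε i = (HahnSeries.single (g i) (1 : R) -
        HahnSeries.single (-e i) 1 * (β i • ∏ j, p j ^ B i j)).orderTop)
    -- cancelling
    (hC : ∀ i, (β i • ∏ j, p j ^ B i j).orderTop < ((e i : Δ) : WithTop Δ) →
      ε i = ((HahnSeries.single (e i) 1 + HahnSeries.single (e i + g i) 1) *
        (β i • ∏ j, p j ^ B i j)⁻¹).orderTop)
    -- honest-B
    (hB : ∀ i, (β i • ∏ j, p j ^ B i j).orderTop = ((e i : Δ) : WithTop Δ) →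
      (β i • ∏ j, p j ^ B i j).leadingCoeff = 1 →
      β i • ∏ j, p j ^ B i j ≠ HahnSeries.single (e i) 1 ∧
      ε i = (HahnSeries.single (g i) (1 : R) -
        HahnSeries.single (-e i) 1 * (α i • ∏ j, p j ^ A i j)).orderTop)
    -- pure tie
    (hP : ∀ i, (β i • ∏ j, p j ^ B i j).orderTop = ((e i : Δ) : WithTop Δ) →
      (β i • ∏ j, p j ^ B i j).leadingCoeff ≠ 1 →
      β i • ∏ j, p j ^ B i j = HahnSeries.single (e i) (β i • ∏ j, p j ^ B i j).leadingCoeff →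
      ε i = g i)
    -- tie
    (hTie : ∀ i, (β i • ∏ j, p j ^ B i j).orderTop = ((e i : Δ) : WithTop Δ) →
      (β i • ∏ j, p j ^ B i j).leadingCoeff ≠ 1 →
      β i • ∏ j, p j ^ B i j ≠ HahnSeries.single (e i) (β i • ∏ j, p j ^ B i j).leadingCoeff →
      ε i = (HahnSeries.single (-e i) (β i • ∏ j, p j ^ B i j).leadingCoeff⁻¹ *
        (β i • ∏ j, p j ^ B i j) - 1).orderTop)
    (hinj : Function.Injective ε) :
    Fintype.card ι ≤ Fintype.card σ := by
  classical
  -- the common decomposition of the variables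
  set ν : σ → Δ := fun j => (p j).order with hν
  set c : σ → R := fun j => if p j = 0 then 1 else (p j).leadingCoeff with hc
  set w : σ → HahnSeries Δ R := fun j =>
    if p j = 0 then 1 else HahnSeries.single (-(p j).order) (p j).leadingCoeff⁻¹ * p j with hw
  have hw_pr : ∀ j, 0 < (w j - 1).orderTop := fun j => by
    by_cases hpj : p j = 0
    · simp [hw, hpj]
    · simp only [hw, if_neg hpj]; exact (decompose hpj).2
  have hpw : ∀ j, p j ≠ 0 → p j = HahnSeries.single (ν j) (c j) * w j := fun j hpj => by
    simp only [hν, hc, hw, if_neg hpj]; exact (decompose hpj).1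
  have hc_ne : ∀ j, c j ≠ 0 := fun j => by
    by_cases hpj : p j = 0
    · simp [hc, hpj]
    · simp only [hc, if_neg hpj]; exact HahnSeries.leadingCoeff_ne_zero.mpr hpj
  -- per coordinate: an integer vector `n_i` with `w^{n_i} ≠ 1` and `ord(w^{n_i} - 1) = ε_i`
  have key : ∀ i, ∃ n : σ → ℤ, ∏ j, w j ^ n j ≠ 1 ∧ (∏ j, w j ^ n j - 1).orderTop = ε i := by
    intro i
    set V := β i • ∏ j, p j ^ B i j with hVdef
    rcases lt_trichotomy (V.orderTop) ((e i : Δ) : WithTop Δ) with hlt | heq | hgt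
    · -- cancelling
      refine ⟨fun j => (A i j : ℤ) - B i j, ?_, ?_⟩ <;>
        rw [cancel_monomial_eq p w ν c hpw hw_pr hc_ne (A i) (B i) (α i) (β i) (e i) (g i) (hg0 i)
          (hsol i) hlt]
      · rw [Ne, sub_eq_self, mul_eq_zero, not_or]
        refine ⟨fun h0 => ?_, inv_ne_zero fun hz => ?_⟩
        · have := orderTop_target (R := R) (e := e i) (hg0 i)
          rw [h0, HahnSeries.orderTop_zero] at this
          exact WithTop.top_ne_coe this
        · have hV0 : V = 0 := by rw [hVdef]; exact hz
          rw [hV0, HahnSeries.orderTop_zero] at hlt; exact not_top_lt hlt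
      · rw [sub_sub_cancel_left, HahnSeries.orderTop_neg]; exact (hC i hlt).symm
    · by_cases hlc : V.leadingCoeff = 1
      · -- honest-B: swap the roles of the two monomials
        obtain ⟨hpure, hε⟩ := hB i heq hlc
        have hsol' : β i • ∏ j, p j ^ B i j + α i • ∏ j, p j ^ A i j =
            HahnSeries.single (e i) 1 + HahnSeries.single (e i + g i) 1 := by rw [add_comm]; exact hsol i
        have hU := orderTop_gt_of_tie_one (hg0 i) (hsol i) heq hlc
        refine ⟨fun j => (B i j : ℤ), ?_, ?_⟩ <;>
          rw [honest_monomial_eq p w ν c hpw hw_pr hc_ne (B i) (β i) (α i • ∏ j, p j ^ A i j) (e i)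
            (g i) (hg0 i) hsol' hU]
        · intro h1
          apply hpure
          have h2 : HahnSeries.single (g i) (1 : R) -
              HahnSeries.single (-e i) 1 * (α i • ∏ j, p j ^ A i j) = 0 := add_eq_left.mp h1
          rw [sub_eq_zero] at h2
          have h3 := congr_arg (fun y => HahnSeries.single (e i) (1 : R) * y) h2
          simp only [HahnSeries.single_mul_single, ← mul_assoc, add_neg_cancel, mul_one,
            HahnSeries.single_zero_one, one_mul] at h3
          -- `U = t^{e+g}` hence `V = T - U = t^e`
          have h4 := hsol i
          rw [← h3] at h4
          exact add_left_cancel (h4.trans (add_comm _ _))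
        · rw [add_sub_cancel_left]; exact hε.symm
      · by_cases hpure : V = HahnSeries.single (e i) V.leadingCoeff
        · -- pure tie: use `A_i`, exact order `g_i`
          have ht := (tie_monomial_eq p w ν c hpw hw_pr hc_ne (A i) (B i) (α i) (β i) (e i) (g i)
            (hg0 i) (hsol i) heq hlc).2 hpure
          have hμ : (1 : R) - V.leadingCoeff ≠ 0 := sub_ne_zero.mpr (Ne.symm hlc)
          refine ⟨fun j => (A i j : ℤ), fun h1 => ?_, ?_⟩
          · have : (HahnSeries.single (g i) (1 - V.leadingCoeff)⁻¹ : HahnSeries Δ R) = 0 := by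
              rw [← ht, h1, sub_self]
            exact HahnSeries.single_ne_zero (inv_ne_zero hμ) this
          · rw [ht, HahnSeries.orderTop_single (inv_ne_zero hμ)]; exact (hP i heq hlc hpure).symm
        · -- tie: use `B_i`
          have ht := (tie_monomial_eq p w ν c hpw hw_pr hc_ne (A i) (B i) (α i) (β i) (e i) (g i)
            (hg0 i) (hsol i) heq hlc).1
          have hlam : V.leadingCoeff ≠ 0 :=
            HahnSeries.leadingCoeff_ne_zero.mpr (leadingCoeff_eq_coeff_of_orderTop heq).1
          rw [← hVdef] at ht
          refine ⟨fun j => (B i j : ℤ), fun h1 => ?_, ?_⟩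
          · apply hpure
            rw [ht] at h1
            have h3 := congr_arg (fun y => HahnSeries.single (e i) V.leadingCoeff * y) h1
            simp only [← mul_assoc, HahnSeries.single_mul_single, add_neg_cancel,
              mul_inv_cancel₀ hlam, HahnSeries.single_zero_one, one_mul, mul_one] at h3
            exact h3
          · rw [ht]; exact (hTie i heq hlc hpure).symm
    · -- honest-A
      have hhon : V = 0 ∨ ((e i : Δ) : WithTop Δ) < V.orderTop := Or.inr hgt
      obtain ⟨hpureA, hε⟩ := hA i hhon
      refine ⟨fun j => (A i j : ℤ), ?_, ?_⟩ <;>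
        rw [honest_monomial_eq p w ν c hpw hw_pr hc_ne (A i) (α i) V (e i) (g i) (hg0 i) (hsol i) hhon]
      · intro h1
        apply hpureA
        have h2 : HahnSeries.single (g i) (1 : R) - HahnSeries.single (-e i) 1 * V = 0 := add_eq_left.mp h1
        rw [sub_eq_zero] at h2
        have h3 := congr_arg (fun y => HahnSeries.single (e i) (1 : R) * y) h2
        simp only [HahnSeries.single_mul_single, ← mul_assoc, add_neg_cancel, mul_one,
          HahnSeries.single_zero_one, one_mul] at h3
        exact h3.symm
      · rw [add_sub_cancel_left]; exact hε.symm
  choose n hn1 hn2 using key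
  refine card_le_of_orderTop_monomial_injective w hw_pr n hn1 fun i i' h => hinj ?_
  simp only at h
  rw [hn2 i, hn2 i'] at h
  exact h

end Summit.ValiantsHypothesis.ValiantsHypothesis.Theorems.BinomialMapsElusiveComplete
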